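import Summits.ABC.ABC.Theses.CubicResolventAllowance
import Summits.ABC.ABC.Theorems.CubicResolventAllowanceResolventDiscBounds
import Literature.NumberTheory.CubicFields.BinaryCubicForms
import Literature.NumberTheory.DiophantineGeometry.Conductor
import Literature.NumberTheory.EllipticCurves.PastenValuationProductMestreOesterleProofs
import HarnessLib

/-!
# Stub-ideation k=3 (FAMILY 3 — probe the extremes), gen 5 — `stub_realCubic` of `IndexSzpiro` (stmt-ABC-22740)

Gen 4 (`StubIdeas3SketchG4.lean`, same directory) exhibited the SATURATING FAMILY inside `ℚ(ζ₇)⁺`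
(`Δ_min = 2⁴7²w⁶`, `N ≤ 3048192·rad w` on the cube curve `F₄₉ = w³`) and proved, modulo one-cycle helpers,
T1 `κ < 6 → ¬IndexSzpiroRealExp κ`, T2 `¬IndexSzpiroRealExp 6`, T3 `stub ↔ (threshold = 6)`.
Gen 5 adds three probes of the extremes and nothing else (the 4-generation consensus — the stub is
class-Szpiro on the real irreducible class, open — is not re-derived):

* §1 GAUGE CALIBRATION of the `ε`-slack: `IndexSzpiroRealGauge g` (`Δ_min ≤ C·|d_K|·N⁶·g(N)`); the stub is the
  power gauge `N^ε` (G1, proved); every polylog gauge `(1+log N)^A` implies the stub (G2/G3, proved); the saturating family forces `A ≥ 3` (G4: the EDS/formal-group mechanism produces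
  excess EXACTLY `≍ (log N)³`, no more) — so the honest sharpened target is `PolylogIndexSzpiroReal 3`.
* §2 THE `Mp` REGIME (perturbation of the one proved case): `LocalIndexSzpiroMp B` = Bennett–Yazdani's local
  Szpiro conjecture restricted to the class; `B = 8` is a CONSEQUENCE of the stub (G5, PROVED via the landed
  `|d_K| ≤ 1944N²`), and its `M = 1` case is Mestre–Oesterlé (G5b, PROVED from the vendored fact, ε-free, exponent 5).
* §3 THE EC-FREE SHADOW: `ThueMahlerDepthBound B` (large-prime depth of `S`-smooth values of real index forms);
  dictionary G6 `ThueMahlerDepthBound B → LocalIndexSzpiroMp (2B+1)` (k2's class parametrisation + Tate).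

`lean check`: rc 0; exactly ONE `sorry` — the body of G6 (L, the curve↔form dictionary); G1–G5, G5b and the gauge
lemmas are PROVED (G4 from the named hypothesis `SaturatingFamily49Growth`, G5b from the vendored Mestre–Oesterlé fact).
-/

open Polynomial NumberField WeierstrassCurve Filter
open Literature.NumberTheory.CubicFields
open Literature.NumberTheory.EllipticCurves

namespace Summit.ABC.ABC.Cruxes.IndexSzpiro.StubIdeas3G5

/-! ## §0 The stub and its one-parameter version (verbatim from gen 4) -/

/-- The stub, verbatim (`line2-birth.lean`, `stub_realCubic`). -/
def StubRealCubic : Prop :=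
  ∀ ε : ℝ, 0 < ε → ∃ C : ℝ, ∀ (W : WeierstrassCurve ℚ) [W.IsElliptic] (K : Type) [Field K] [NumberField K],
    Irreducible W.twoTorsionPolynomial.toPoly → Module.finrank ℚ K = 3 →
    (∃ θ : K, aeval θ W.twoTorsionPolynomial.toPoly = 0) → 0 < NumberField.discr K →
    (W.minimalDiscriminantNorm ℤ : ℝ) ≤ C * |(NumberField.discr K : ℝ)| * (W.conductorNorm ℤ : ℝ) ^ (6 + ε)

/-- `IndexSzpiroRealExp κ`: the real-irreducible-class index bound with conductor exponent `κ`. -/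
def IndexSzpiroRealExp (κ : ℝ) : Prop :=
  ∃ C : ℝ, ∀ (W : WeierstrassCurve ℚ) [W.IsElliptic] (K : Type) [Field K] [NumberField K],
    Irreducible W.twoTorsionPolynomial.toPoly → Module.finrank ℚ K = 3 →
    (∃ θ : K, aeval θ W.twoTorsionPolynomial.toPoly = 0) → 0 < NumberField.discr K →
    (W.minimalDiscriminantNorm ℤ : ℝ) ≤ C * |(NumberField.discr K : ℝ)| * (W.conductorNorm ℤ : ℝ) ^ κ

theorem stub_iff : StubRealCubic ↔ ∀ ε : ℝ, 0 < ε → IndexSzpiroRealExp (6 + ε) := Iff.rfl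

/-! ## §1 Gauge calibration of the `ε`-slack -/

/-- `IndexSzpiroRealGauge g`: the class index bound with the `ε`-slack replaced by an explicit GAUGE `g(N)`:
`Δ_min ≤ C·|d_K|·N⁶·g(N)` on the real irreducible class. -/
def IndexSzpiroRealGauge (g : ℕ → ℝ) : Prop :=
  ∃ C : ℝ, ∀ (W : WeierstrassCurve ℚ) [W.IsElliptic] (K : Type) [Field K] [NumberField K],
    Irreducible W.twoTorsionPolynomial.toPoly → Module.finrank ℚ K = 3 →
    (∃ θ : K, aeval θ W.twoTorsionPolynomial.toPoly = 0) → 0 < NumberField.discr K →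
    (W.minimalDiscriminantNorm ℤ : ℝ) ≤
      C * |(NumberField.discr K : ℝ)| * ((W.conductorNorm ℤ : ℝ) ^ (6 : ℕ) * g (W.conductorNorm ℤ))

/-- The polylogarithmic gauge `(1 + log N)^A` (`1 +` keeps the base `≥ 1`; every `E/ℚ` has `N ≥ 11` anyway). -/
def PolylogIndexSzpiroReal (A : ℝ) : Prop :=
  IndexSzpiroRealGauge (fun N => (1 + Real.log N) ^ A)

theorem rpow_six_add (W : WeierstrassCurve ℚ) [W.IsElliptic] (ε : ℝ) :
    (W.conductorNorm ℤ : ℝ) ^ (6 + ε) = (W.conductorNorm ℤ : ℝ) ^ (6 : ℕ) * (W.conductorNorm ℤ : ℝ) ^ ε := by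
  have hN : (0 : ℝ) < (W.conductorNorm ℤ : ℝ) := by exact_mod_cast W.conductorNorm_pos_holds
  rw [Real.rpow_add hN, ← Real.rpow_natCast]
  norm_num

/-- **G1 (PROVED).** The stub's `ε`-form IS the power gauge `g(N) = N^ε`. -/
theorem gauge_rpow_iff (ε : ℝ) :
    IndexSzpiroRealGauge (fun N => (N : ℝ) ^ ε) ↔ IndexSzpiroRealExp (6 + ε) := by
  constructor
  · rintro ⟨C, hC⟩
    refine ⟨C, fun W _ K _ _ hirr h3 hθ hd => ?_⟩
    rw [rpow_six_add]
    exact hC W K hirr h3 hθ hd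
  · rintro ⟨C, hC⟩
    refine ⟨C, fun W _ K _ _ hirr h3 hθ hd => ?_⟩
    have h := hC W K hirr h3 hθ hd
    rw [rpow_six_add] at h
    exact h

theorem stub_iff_gauge :
    StubRealCubic ↔ ∀ ε : ℝ, 0 < ε → IndexSzpiroRealGauge (fun N => (N : ℝ) ^ ε) := by
  simp only [stub_iff, gauge_rpow_iff]

/-- **Gauge domination (PROVED).** A gauge dominated by a multiple of another (on `N ≥ 1`) gives the weaker bound. -/
theorem gauge_mono {g₁ g₂ : ℕ → ℝ} {c : ℝ} (hc : 0 ≤ c) (hg₁ : ∀ N : ℕ, 1 ≤ N → 0 ≤ g₁ N)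
    (hg : ∀ N : ℕ, 1 ≤ N → g₁ N ≤ c * g₂ N) : IndexSzpiroRealGauge g₁ → IndexSzpiroRealGauge g₂ := by
  rintro ⟨C, hC⟩
  refine ⟨max C 0 * c, fun W _ K _ _ hirr h3 hθ hd => (hC W K hirr h3 hθ hd).trans ?_⟩
  have hN1 : 1 ≤ W.conductorNorm ℤ := W.conductorNorm_pos_holds
  have h0 : 0 ≤ |(NumberField.discr K : ℝ)| := abs_nonneg _
  have hN6 : 0 ≤ (W.conductorNorm ℤ : ℝ) ^ (6 : ℕ) := by positivity
  have hX : 0 ≤ |(NumberField.discr K : ℝ)| * ((W.conductorNorm ℤ : ℝ) ^ (6 : ℕ) * g₁ (W.conductorNorm ℤ)) :=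
    mul_nonneg h0 (mul_nonneg hN6 (hg₁ _ hN1))
  have _hc := hc
  calc C * |(NumberField.discr K : ℝ)| * ((W.conductorNorm ℤ : ℝ) ^ (6 : ℕ) * g₁ (W.conductorNorm ℤ))
      = C * (|(NumberField.discr K : ℝ)| * ((W.conductorNorm ℤ : ℝ) ^ (6 : ℕ) * g₁ (W.conductorNorm ℤ))) := by
        ring
    _ ≤ max C 0 * (|(NumberField.discr K : ℝ)| * ((W.conductorNorm ℤ : ℝ) ^ (6 : ℕ) * g₁ (W.conductorNorm ℤ))) :=
        mul_le_mul_of_nonneg_right (le_max_left _ _) hX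
    _ ≤ max C 0 * (|(NumberField.discr K : ℝ)| * ((W.conductorNorm ℤ : ℝ) ^ (6 : ℕ) * (c * g₂ (W.conductorNorm ℤ)))) :=
        mul_le_mul_of_nonneg_left (mul_le_mul_of_nonneg_left
          (mul_le_mul_of_nonneg_left (hg _ hN1) hN6) h0) (le_max_right _ _)
    _ = max C 0 * c * |(NumberField.discr K : ℝ)| * ((W.conductorNorm ℤ : ℝ) ^ (6 : ℕ) * g₂ (W.conductorNorm ℤ)) := by
        ring

/-- **G2 (PROVED).** Every polylog is dominated by every power:
`(1 + log x)^A ≤ c_{A,ε}·x^ε` for `x ≥ 1`.  (`A ≤ 0`: `c = 1`; `A > 0`: `1 + log x ≤ (1 + A/ε)·x^{ε/A}` from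
`Real.log_le_sub_one_of_pos` / `Real.add_one_le_exp`, then `Real.rpow_le_rpow`; or `isLittleO_log_rpow_atTop` +
compactness of `[1, X₀]`.) -/
theorem one_add_log_rpow_le (A ε : ℝ) (hε : 0 < ε) :
    ∃ c : ℝ, 0 < c ∧ ∀ x : ℝ, 1 ≤ x → (1 + Real.log x) ^ A ≤ c * x ^ ε := by
  rcases le_or_gt A 0 with hA | hA
  · refine ⟨1, one_pos, fun x hx => ?_⟩
    have hlog : 0 ≤ Real.log x := Real.log_nonneg hx
    calc (1 + Real.log x) ^ A ≤ 1 := Real.rpow_le_one_of_one_le_of_nonpos (by linarith) hA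
      _ ≤ 1 * x ^ ε := by rw [one_mul]; exact Real.one_le_rpow hx hε.le
  · set M : ℝ := max 1 (A / ε) with hM
    have hM1 : 1 ≤ M := le_max_left _ _
    have hM0 : 0 ≤ M := le_trans zero_le_one hM1
    refine ⟨M ^ A, Real.rpow_pos_of_pos (lt_of_lt_of_le one_pos hM1) A, fun x hx => ?_⟩
    have hx0 : 0 < x := lt_of_lt_of_le one_pos hx
    have hlog : 0 ≤ Real.log x := Real.log_nonneg hx
    -- `y := (ε/A)·log x ≥ 0`, `1 + y ≤ exp y = x^(ε/A)`
    have hy : 1 + ε / A * Real.log x ≤ x ^ (ε / A) := by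
      rw [Real.rpow_def_of_pos hx0, mul_comm (Real.log x)]
      linarith [Real.add_one_le_exp (ε / A * Real.log x)]
    have hyx : 0 ≤ ε / A * Real.log x := mul_nonneg (div_pos hε hA).le hlog
    have hone : (A / ε) * (ε / A) = 1 := by
      rw [div_mul_div_comm, mul_comm A ε, div_self (mul_ne_zero hε.ne' hA.ne')]
    have hlx : Real.log x = (A / ε) * (ε / A * Real.log x) := by rw [← mul_assoc, hone, one_mul]
    have h2 : 1 + Real.log x ≤ M * (1 + ε / A * Real.log x) := by
      calc 1 + Real.log x = 1 + (A / ε) * (ε / A * Real.log x) := by rw [← hlx]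
        _ ≤ M + M * (ε / A * Real.log x) :=
            add_le_add hM1 (mul_le_mul_of_nonneg_right (le_max_right _ _) hyx)
        _ = M * (1 + ε / A * Real.log x) := by ring
    have h3 : 1 + Real.log x ≤ M * x ^ (ε / A) := h2.trans (mul_le_mul_of_nonneg_left hy hM0)
    have hb0 : 0 ≤ 1 + Real.log x := by linarith
    calc (1 + Real.log x) ^ A ≤ (M * x ^ (ε / A)) ^ A := Real.rpow_le_rpow hb0 h3 hA.le
      _ = M ^ A * (x ^ (ε / A)) ^ A := Real.mul_rpow hM0 (Real.rpow_nonneg hx0.le _)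
      _ = M ^ A * x ^ ε := by rw [← Real.rpow_mul hx0.le, div_mul_cancel₀ ε hA.ne']

/-- **G3 (PROVED).** Any polylogarithmic gauge implies the stub: `PolylogIndexSzpiroReal A → stub`.
So `PL_A` (any `A`) is a legitimate SHARPENED TARGET for the stub prover; by G4 only `A ≥ 3` is available. -/
theorem stub_of_polylog {A : ℝ} (h : PolylogIndexSzpiroReal A) : StubRealCubic := by
  rw [stub_iff_gauge]
  intro ε hε
  obtain ⟨c, hc, hcx⟩ := one_add_log_rpow_le A ε hε
  refine gauge_mono hc.le (fun N hN => ?_) (fun N hN => hcx N (by exact_mod_cast hN)) h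
  have hlog : 0 ≤ Real.log (N : ℝ) := Real.log_nonneg (by exact_mod_cast hN)
  exact Real.rpow_nonneg (by linarith) _

/-- **The saturating family, packaged with its archimedean size** (gen-4 H3–H7 on the cube curve `F₄₉ = w³` inside
`K₄₉ = ℚ(ζ₇)⁺`, members `m = 5·29^k` of the EDS of `γ₁ = (84,756)` on `y² = x³ − 21168`, plus the one new input
`log e_m ≤ c·m²` — Néron–Tate: `log e_m = ĥ(γ₁)m² + O(1)`): for every `k` a class member over a field with
`d_K = 49` and an integer `w ≥ 1` with `29^{k+1}·rad w ≤ w`, `w⁶ ≤ Δ_min`, `N ≤ 2⁸3⁵7²·rad w`, `log w ≤ c·29^{2k}`.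
Status: H3b/H1 proved in gen 4; H3a, H5a, H5b one cycle each; H6/H7 (points of `E₇₈₄`, `29`-adic lifting in the
formal group) L/XL — keep this `def` as the NAMED HYPOTHESIS of G4 until they land. -/
def SaturatingFamily49Growth : Prop :=
  ∃ c : ℝ, ∀ k : ℕ, ∃ (W : WeierstrassCurve ℚ) (_ : W.IsElliptic) (K : Type) (_ : Field K) (_ : NumberField K)
    (w : ℕ), Irreducible W.twoTorsionPolynomial.toPoly ∧ Module.finrank ℚ K = 3 ∧
    (∃ θ : K, aeval θ W.twoTorsionPolynomial.toPoly = 0) ∧ NumberField.discr K = 49 ∧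
    0 < w ∧ 29 ^ (k + 1) * UniqueFactorizationMonoid.radical w ≤ w ∧ w ^ 6 ≤ W.minimalDiscriminantNorm ℤ ∧
    W.conductorNorm ℤ ≤ 3048192 * UniqueFactorizationMonoid.radical w ∧
    Real.log w ≤ c * (29 : ℝ) ^ (2 * k)

/-- **G4 (PROVED from the named hypothesis; template = gen-4 `not_indexSzpiroRealExp_six`).** The polylog exponent is `≥ 3`:
on member `k`, `PL_A` gives `w⁶ ≤ C·49·(3048192·rad w)⁶·(1 + log N)^A ≤ C'·(w/29^{k+1})⁶·(c'·29^{2k})^A`, i.e.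
`29^{6k} ≤ C''·29^{2Ak}` — false for `k` large when `2A < 6`.  EXACTNESS: along ANY elliptic-divisibility /
formal-group subfamily the excess `Δ_min/(d_K N⁶) = (w/rad w)⁶·O(1)` has `w/rad w ∣ m·∏_{q} q^{v_q(e_{r_q})−1}`,
`log N ≍ ĥ m²`, so excess `≪ (log N)³` up to the sporadic square factors `q² ∣ e_{r_q}` — the genus-≤ 1
mechanisms are CAPPED at `(log N)³`.  CONTRAST (tree theorems): in the SPLIT 2-torsion class `PL_A` fails for EVERY
`A` — the Frey curves `y² = x(x−a)(x+b)` of `Literature.Barriers.ABC.exists_semistable_curve_polylog_excess` /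
`not_szpiro_polylog_semistable` (SzpiroEpsilonCannotBeDroppedHolds.lean) and Masser's `exp((24−δ)√(log N)/log log N)`
excess `Literature.Barriers.ABC.Masser.masser_theorem`; no such construction is known with IRREDUCIBLE 2-torsion. -/
theorem polylog_mono {A B : ℝ} (hAB : A ≤ B) : PolylogIndexSzpiroReal A → PolylogIndexSzpiroReal B := by
  refine gauge_mono (c := 1) zero_le_one (fun N hN => ?_) (fun N hN => ?_)
  · have h1 : (0 : ℝ) ≤ 1 + Real.log N := by
      have := Real.log_nonneg (show (1 : ℝ) ≤ (N : ℝ) by exact_mod_cast hN); linarith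
    exact Real.rpow_nonneg h1 _
  · rw [one_mul]
    have h1 : (1 : ℝ) ≤ 1 + Real.log N := by
      have := Real.log_nonneg (show (1 : ℝ) ≤ (N : ℝ) by exact_mod_cast hN); linarith
    exact Real.rpow_le_rpow_of_exponent_le h1 hAB

theorem not_polylog_of_lt_three (hfam : SaturatingFamily49Growth) {A : ℝ} (hA : A < 3) :
    ¬ PolylogIndexSzpiroReal A := by
  intro hPL
  -- wlog `0 ≤ A`: pass to `B = max A 0 ∈ [0, 3)`
  set B : ℝ := max A 0 with hBdef
  have hB0 : 0 ≤ B := le_max_right _ _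
  have hB3 : B < 3 := max_lt hA (by norm_num)
  obtain ⟨C, hC⟩ := polylog_mono (le_max_left A 0) hPL
  obtain ⟨c, hc⟩ := hfam
  have hlogA : 0 ≤ Real.log (3048192 : ℝ) := Real.log_nonneg (by norm_num)
  set c₁ : ℝ := 1 + Real.log 3048192 + max c 0 with hc₁
  have hc₁0 : 0 ≤ c₁ := by have := le_max_right c 0; linarith
  set C₂ : ℝ := max C 0 * 49 * (3048192 : ℝ) ^ (6 : ℕ) * c₁ ^ B with hC₂
  have hC₂0 : 0 ≤ C₂ := by positivity
  -- choose `k` with `C₂ < (29^(6-2B))^k`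
  have h29 : (1 : ℝ) < (29 : ℝ) ^ (6 - 2 * B) := Real.one_lt_rpow (by norm_num) (by linarith)
  obtain ⟨k, hk⟩ := pow_unbounded_of_one_lt C₂ h29
  obtain ⟨W, hW, K, hF, hNF, w, hirr, h3, hθ, hd, hw0, hpow, hw6, hN, hlog⟩ := hc k
  have hb := hC W K hirr h3 hθ (by rw [hd]; norm_num)
  -- the cast real quantities
  have hx0 : (0 : ℝ) < (w : ℝ) := by exact_mod_cast hw0
  have hr1 : (1 : ℝ) ≤ ((UniqueFactorizationMonoid.radical w : ℕ) : ℝ) := by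
    exact_mod_cast Nat.pos_of_ne_zero (UniqueFactorizationMonoid.radical_ne_zero (a := w))
  have hr0 : (0 : ℝ) < ((UniqueFactorizationMonoid.radical w : ℕ) : ℝ) := by linarith
  have hrx : ((UniqueFactorizationMonoid.radical w : ℕ) : ℝ) ≤ (w : ℝ) := by
    exact_mod_cast Nat.le_of_dvd hw0 (UniqueFactorizationMonoid.radical_dvd_self (a := w))
  have hN1 : (1 : ℝ) ≤ (W.conductorNorm ℤ : ℝ) := by exact_mod_cast W.conductorNorm_pos_holds
  have hN0 : (0 : ℝ) < (W.conductorNorm ℤ : ℝ) := by linarith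
  have hNr : (W.conductorNorm ℤ : ℝ) ≤ 3048192 * ((UniqueFactorizationMonoid.radical w : ℕ) : ℝ) := by
    exact_mod_cast hN
  have hpow' : (29 : ℝ) ^ (k + 1) * ((UniqueFactorizationMonoid.radical w : ℕ) : ℝ) ≤ (w : ℝ) := by
    exact_mod_cast hpow
  have hw6' : (w : ℝ) ^ (6 : ℕ) ≤ (W.minimalDiscriminantNorm ℤ : ℝ) := by exact_mod_cast hw6
  have hd49 : |(NumberField.discr K : ℝ)| = 49 := by
    rw [show (NumberField.discr K : ℝ) = ((49 : ℤ) : ℝ) by exact_mod_cast hd]; norm_num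
  have h29k1 : (1 : ℝ) ≤ (29 : ℝ) ^ (2 * k) := one_le_pow₀ (by norm_num)
  -- (iii) the gauge on the member: `1 + log N ≤ c₁·29^(2k)`
  have hlogN : 1 + Real.log (W.conductorNorm ℤ : ℝ) ≤ c₁ * (29 : ℝ) ^ (2 * k) := by
    have h1 : Real.log (W.conductorNorm ℤ : ℝ) ≤ Real.log 3048192 + Real.log (w : ℝ) := by
      rw [← Real.log_mul (by norm_num) hx0.ne']
      exact Real.log_le_log hN0 (hNr.trans (mul_le_mul_of_nonneg_left hrx (by norm_num)))
    have h2 : Real.log (w : ℝ) ≤ max c 0 * (29 : ℝ) ^ (2 * k) :=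
      hlog.trans (mul_le_mul_of_nonneg_right (le_max_left _ _) (by positivity))
    have h3 : 1 + Real.log 3048192 ≤ (1 + Real.log 3048192) * (29 : ℝ) ^ (2 * k) :=
      le_mul_of_one_le_right (by linarith) h29k1
    calc 1 + Real.log (W.conductorNorm ℤ : ℝ) ≤ 1 + Real.log 3048192 + max c 0 * (29 : ℝ) ^ (2 * k) := by
          linarith
      _ ≤ (1 + Real.log 3048192) * (29 : ℝ) ^ (2 * k) + max c 0 * (29 : ℝ) ^ (2 * k) := by linarith
      _ = c₁ * (29 : ℝ) ^ (2 * k) := by rw [hc₁]; ring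
  have hg0 : (0 : ℝ) ≤ 1 + Real.log (W.conductorNorm ℤ : ℝ) := by
    have := Real.log_nonneg hN1; linarith
  have hgauge : (1 + Real.log (W.conductorNorm ℤ : ℝ)) ^ B ≤ c₁ ^ B * ((29 : ℝ) ^ (2 * k)) ^ B := by
    rw [← Real.mul_rpow hc₁0 (by positivity)]
    exact Real.rpow_le_rpow hg0 hlogN hB0
  -- (ii) `N^6 ≤ A₀^6 · r^6`
  have hN6 : (W.conductorNorm ℤ : ℝ) ^ (6 : ℕ) ≤
      (3048192 : ℝ) ^ (6 : ℕ) * ((UniqueFactorizationMonoid.radical w : ℕ) : ℝ) ^ (6 : ℕ) := by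
    rw [← mul_pow]; exact pow_le_pow_left₀ hN0.le hNr 6
  -- (i)+(ii)+(iv): `w^6 ≤ C₂ · r^6 · (29^(2k))^B`
  have hT0 : (0 : ℝ) < ((29 : ℝ) ^ (2 * k)) ^ B := Real.rpow_pos_of_pos (by positivity) _
  have hmain : (w : ℝ) ^ (6 : ℕ) ≤
      C₂ * ((UniqueFactorizationMonoid.radical w : ℕ) : ℝ) ^ (6 : ℕ) * ((29 : ℝ) ^ (2 * k)) ^ B := by
    have hb' : (W.minimalDiscriminantNorm ℤ : ℝ) ≤ max C 0 * 49 *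
        ((W.conductorNorm ℤ : ℝ) ^ (6 : ℕ) * (1 + Real.log (W.conductorNorm ℤ : ℝ)) ^ B) := by
      rw [hd49] at hb
      refine hb.trans ?_
      have h0 : (0 : ℝ) ≤ (W.conductorNorm ℤ : ℝ) ^ (6 : ℕ) * (1 + Real.log (W.conductorNorm ℤ : ℝ)) ^ B :=
        mul_nonneg (by positivity) (Real.rpow_nonneg hg0 _)
      exact mul_le_mul_of_nonneg_right (mul_le_mul_of_nonneg_right (le_max_left _ _) (by norm_num)) h0
    have hprod : (W.conductorNorm ℤ : ℝ) ^ (6 : ℕ) * (1 + Real.log (W.conductorNorm ℤ : ℝ)) ^ B ≤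
        ((3048192 : ℝ) ^ (6 : ℕ) * ((UniqueFactorizationMonoid.radical w : ℕ) : ℝ) ^ (6 : ℕ)) *
          (c₁ ^ B * ((29 : ℝ) ^ (2 * k)) ^ B) :=
      mul_le_mul hN6 hgauge (Real.rpow_nonneg hg0 _) (by positivity)
    calc (w : ℝ) ^ (6 : ℕ) ≤ (W.minimalDiscriminantNorm ℤ : ℝ) := hw6'
      _ ≤ max C 0 * 49 * (((3048192 : ℝ) ^ (6 : ℕ) * ((UniqueFactorizationMonoid.radical w : ℕ) : ℝ) ^ (6 : ℕ)) *
          (c₁ ^ B * ((29 : ℝ) ^ (2 * k)) ^ B)) :=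
          hb'.trans (mul_le_mul_of_nonneg_left hprod (by positivity))
      _ = C₂ * ((UniqueFactorizationMonoid.radical w : ℕ) : ℝ) ^ (6 : ℕ) * ((29 : ℝ) ^ (2 * k)) ^ B := by
          rw [hC₂]; ring
  -- (vi) multiply by `(29^(k+1))^6` and use `29^(k+1)·r ≤ w`: `(29^(k+1))^6 ≤ C₂·(29^(2k))^B`
  have hkey : ((29 : ℝ) ^ (k + 1)) ^ (6 : ℕ) ≤ C₂ * ((29 : ℝ) ^ (2 * k)) ^ B := by
    have h1 : ((29 : ℝ) ^ (k + 1)) ^ (6 : ℕ) * (w : ℝ) ^ (6 : ℕ) ≤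
        C₂ * ((29 : ℝ) ^ (2 * k)) ^ B * (w : ℝ) ^ (6 : ℕ) := by
      calc ((29 : ℝ) ^ (k + 1)) ^ (6 : ℕ) * (w : ℝ) ^ (6 : ℕ)
          ≤ ((29 : ℝ) ^ (k + 1)) ^ (6 : ℕ) *
            (C₂ * ((UniqueFactorizationMonoid.radical w : ℕ) : ℝ) ^ (6 : ℕ) * ((29 : ℝ) ^ (2 * k)) ^ B) :=
            mul_le_mul_of_nonneg_left hmain (by positivity)
        _ = C₂ * ((29 : ℝ) ^ (2 * k)) ^ B *
            ((29 : ℝ) ^ (k + 1) * ((UniqueFactorizationMonoid.radical w : ℕ) : ℝ)) ^ (6 : ℕ) := by ring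
        _ ≤ C₂ * ((29 : ℝ) ^ (2 * k)) ^ B * (w : ℝ) ^ (6 : ℕ) :=
            mul_le_mul_of_nonneg_left (pow_le_pow_left₀ (by positivity) hpow' 6) (by positivity)
    exact le_of_mul_le_mul_right h1 (by positivity)
  -- (vii)+(viii): `(29^(k+1))^6 < (29^(6-2B))^k · (29^(2k))^B = 29^(6k) ≤ (29^(k+1))^6`
  have hlt : ((29 : ℝ) ^ (k + 1)) ^ (6 : ℕ) < ((29 : ℝ) ^ (6 - 2 * B)) ^ k * ((29 : ℝ) ^ (2 * k)) ^ B :=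
    hkey.trans_lt (mul_lt_mul_of_pos_right hk hT0)
  have hexp : ((29 : ℝ) ^ (6 - 2 * B)) ^ k * ((29 : ℝ) ^ (2 * k)) ^ B = (29 : ℝ) ^ ((6 * k : ℕ) : ℝ) := by
    rw [← Real.rpow_natCast ((29 : ℝ) ^ (6 - 2 * B)) k, ← Real.rpow_mul (by norm_num),
      ← Real.rpow_natCast (29 : ℝ) (2 * k), ← Real.rpow_mul (by norm_num), ← Real.rpow_add (by norm_num)]
    congr 1; push_cast; ring
  have hge : (29 : ℝ) ^ ((6 * k : ℕ) : ℝ) ≤ ((29 : ℝ) ^ (k + 1)) ^ (6 : ℕ) := by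
    rw [Real.rpow_natCast, ← pow_mul]
    exact pow_le_pow_right₀ (by norm_num) (by omega)
  linarith [hexp ▸ hlt]

/-! ## §2 The `Mp` regime: local index-Szpiro at one large prime (perturbation of the proved case `M = 1`) -/

/-- `LocalIndexSzpiroMp B`: for fixed tame part `M` and all large primes `p ∤ M`, every class curve of conductor
`N = M·p` has `n_p = v_p(Δ_min) ≤ B`.  Bennett–Yazdani, Exp. Math. 21 (2012) Conj. 1.2 (`B = 6`, all `E/ℚ`);
`M = 1`: Mestre–Oesterlé (`B = 5`, G5b). -/
def LocalIndexSzpiroMp (B : ℕ) : Prop :=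
  ∀ M : ℕ, 0 < M → ∃ p₀ : ℕ, ∀ (W : WeierstrassCurve ℚ) [W.IsElliptic] (K : Type) [Field K] [NumberField K],
    Irreducible W.twoTorsionPolynomial.toPoly → Module.finrank ℚ K = 3 →
    (∃ θ : K, aeval θ W.twoTorsionPolynomial.toPoly = 0) → 0 < NumberField.discr K →
    ∀ p : ℕ, p.Prime → p₀ ≤ p → ¬ p ∣ M → W.conductorNorm ℤ = M * p →
      (W.minimalDiscriminantNorm ℤ).factorization p ≤ B

/-- **G5 (PROVED).** The stub implies the local rung with `B = 8`: `p⁹ ≤ p^{n_p} ≤ Δ_min` (`Nat.ordProj_le`)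
`≤ C_{½}·|d_K|·N^{6½} ≤ max C 0·1944·N²·N^{6½} = C'·p^{8½}` (landed
`Summit.ABC.ABC.Theorems.resolventDiscBounds_proof : |d_K| ≤ 1944·N²`), so `p ≤ C'²`: take `p₀ > C'²`.  (`B = 7` would follow from the census-true `|d_K| ∣ 8·(tame)·p`, j344634; `B = 6` is
Bennett–Yazdani's conjecture and is NOT implied by the stub.) -/
theorem localIndexSzpiroMp_of_stub (h : StubRealCubic) : LocalIndexSzpiroMp 8 := by
  intro M hM
  obtain ⟨C, hC⟩ := h (1 / 2) (by norm_num)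
  set C' : ℝ := max C 0 * 1944 * (M : ℝ) ^ (8 + 1 / 2 : ℝ) with hC'
  have hC'0 : 0 ≤ C' := by positivity
  obtain ⟨p₀, hp₀⟩ := exists_nat_gt (C' ^ 2)
  refine ⟨p₀, fun W _ K _ _ hirr h3 hθ hd p hp hpp hpM hN => ?_⟩
  by_contra hv
  push Not at hv
  -- (1) `p⁹ ≤ p^{n_p} ≤ Δ_min`
  have hΔ0 : 0 < W.minimalDiscriminantNorm ℤ := W.minimalDiscriminantNorm_pos_holds
  have hpv : p ^ (W.minimalDiscriminantNorm ℤ).factorization p ≤ W.minimalDiscriminantNorm ℤ :=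
    Nat.ordProj_le p hΔ0.ne'
  have hp9 : p ^ 9 ≤ W.minimalDiscriminantNorm ℤ := (Nat.pow_le_pow_right hp.pos hv).trans hpv
  have hp0 : (0 : ℝ) < (p : ℝ) := by exact_mod_cast hp.pos
  have hM0 : (0 : ℝ) ≤ (M : ℝ) := Nat.cast_nonneg _
  -- (2) `Δ_min ≤ C·|d_K|·N^{6½} ≤ max C 0 · 1944 N² · N^{6½} = C'·p^{8½}`
  have hdK := (Summit.ABC.ABC.Theorems.resolventDiscBounds_proof).1 W K hirr h3 hθ
  have hb := hC W K hirr h3 hθ hd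
  have hNr : (W.conductorNorm ℤ : ℝ) = (M : ℝ) * (p : ℝ) := by exact_mod_cast hN
  have hN0 : (0 : ℝ) ≤ (W.conductorNorm ℤ : ℝ) := Nat.cast_nonneg _
  have hNκ : 0 ≤ (W.conductorNorm ℤ : ℝ) ^ (6 + 1 / 2 : ℝ) := Real.rpow_nonneg hN0 _
  have step1 : (W.minimalDiscriminantNorm ℤ : ℝ) ≤
      max C 0 * (1944 * (W.conductorNorm ℤ : ℝ) ^ (2 : ℕ)) * (W.conductorNorm ℤ : ℝ) ^ (6 + 1 / 2 : ℝ) := by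
    calc (W.minimalDiscriminantNorm ℤ : ℝ)
        ≤ C * |(NumberField.discr K : ℝ)| * (W.conductorNorm ℤ : ℝ) ^ (6 + 1 / 2 : ℝ) := hb
      _ ≤ max C 0 * |(NumberField.discr K : ℝ)| * (W.conductorNorm ℤ : ℝ) ^ (6 + 1 / 2 : ℝ) :=
          mul_le_mul_of_nonneg_right (mul_le_mul_of_nonneg_right (le_max_left _ _) (abs_nonneg _)) hNκ
      _ ≤ max C 0 * (1944 * (W.conductorNorm ℤ : ℝ) ^ (2 : ℕ)) * (W.conductorNorm ℤ : ℝ) ^ (6 + 1 / 2 : ℝ) :=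
          mul_le_mul_of_nonneg_right (mul_le_mul_of_nonneg_left hdK (le_max_right _ _)) hNκ
  have hpow : (1944 * (W.conductorNorm ℤ : ℝ) ^ (2 : ℕ)) * (W.conductorNorm ℤ : ℝ) ^ (6 + 1 / 2 : ℝ) =
      1944 * ((M : ℝ) ^ (8 + 1 / 2 : ℝ) * (p : ℝ) ^ (8 + 1 / 2 : ℝ)) := by
    rw [← Real.mul_rpow hM0 hp0.le, ← hNr, mul_assoc, ← Real.rpow_natCast _ 2, ← Real.rpow_add
      (by rw [hNr]; positivity)]
    norm_num
  have step2 : (W.minimalDiscriminantNorm ℤ : ℝ) ≤ C' * (p : ℝ) ^ (8 + 1 / 2 : ℝ) := by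
    calc (W.minimalDiscriminantNorm ℤ : ℝ)
        ≤ max C 0 * ((1944 * (W.conductorNorm ℤ : ℝ) ^ (2 : ℕ)) * (W.conductorNorm ℤ : ℝ) ^ (6 + 1 / 2 : ℝ)) := by
          rw [← mul_assoc]; exact step1
      _ = C' * (p : ℝ) ^ (8 + 1 / 2 : ℝ) := by rw [hpow, hC']; ring
  -- (3) `p⁹ = p^{8½}·p^{½} ≤ C'·p^{8½}` ⇒ `p^{½} ≤ C'` ⇒ `p ≤ C'² < p₀ ≤ p`
  have h9 : (p : ℝ) ^ (8 + 1 / 2 : ℝ) * (p : ℝ) ^ (1 / 2 : ℝ) ≤ (p : ℝ) ^ (8 + 1 / 2 : ℝ) * C' := by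
    have : (p : ℝ) ^ (8 + 1 / 2 : ℝ) * (p : ℝ) ^ (1 / 2 : ℝ) = ((p ^ 9 : ℕ) : ℝ) := by
      rw [← Real.rpow_add hp0]; norm_num
    rw [this, mul_comm _ C']
    exact (by exact_mod_cast hp9 : ((p ^ 9 : ℕ) : ℝ) ≤ (W.minimalDiscriminantNorm ℤ : ℝ)).trans step2
  have hhalf : (p : ℝ) ^ (1 / 2 : ℝ) ≤ C' := le_of_mul_le_mul_left h9 (Real.rpow_pos_of_pos hp0 _)
  have hpC : (p : ℝ) ≤ C' ^ 2 := by
    have h2 : ((p : ℝ) ^ (1 / 2 : ℝ)) ^ (2 : ℕ) = p := by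
      rw [← Real.rpow_natCast, ← Real.rpow_mul hp0.le]; norm_num
    rw [← h2]
    exact pow_le_pow_left₀ (Real.rpow_nonneg hp0.le _) hhalf 2
  have : (p₀ : ℝ) ≤ (p : ℝ) := by exact_mod_cast hpp
  linarith

/-- **G5b, step 1 (PROVED from the vendored fact).** Prime conductor: `Δ_min ≤ N⁵`
(`minimalDiscriminantNorm_eq_pow_of_prime_conductorNorm` + `mestreOesterle_factorization_le_five`). -/
theorem minimalDiscriminantNorm_le_pow_five (hMO : mestreOesterle_factorization_le_five)
    (W : WeierstrassCurve ℚ) [W.IsElliptic] (hp : (W.conductorNorm ℤ).Prime) :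
    W.minimalDiscriminantNorm ℤ ≤ W.conductorNorm ℤ ^ 5 := by
  rw [W.minimalDiscriminantNorm_eq_pow_of_prime_conductorNorm hp]
  exact Nat.pow_le_pow_right hp.pos (hMO W hp)

/-- **G5b (PROVED modulo the vendored Mestre–Oesterlé fact; the `M = 1` rung of §2 in the stub's own currency,
ε-FREE and with exponent 5).** On prime-conductor class curves `Δ_min ≤ N⁵ ≤ 1·|d_K|·N^κ` for every `κ ≥ 5`. -/
theorem stubBound_of_prime_conductor (hMO : mestreOesterle_factorization_le_five)
    (W : WeierstrassCurve ℚ) [W.IsElliptic] (K : Type) [Field K] [NumberField K]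
    (hp : (W.conductorNorm ℤ).Prime) {κ : ℝ} (hκ : 5 ≤ κ) :
    (W.minimalDiscriminantNorm ℤ : ℝ) ≤ 1 * |(NumberField.discr K : ℝ)| * (W.conductorNorm ℤ : ℝ) ^ κ := by
  have h5 := minimalDiscriminantNorm_le_pow_five hMO W hp
  have hN1 : (1 : ℝ) ≤ (W.conductorNorm ℤ : ℝ) := by exact_mod_cast hp.one_lt.le
  have hd1 : (1 : ℝ) ≤ |(NumberField.discr K : ℝ)| := by
    have h1 : (1 : ℤ) ≤ |NumberField.discr K| := Int.one_le_abs (NumberField.discr_ne_zero K)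
    exact_mod_cast h1
  have h0 : 0 ≤ (W.conductorNorm ℤ : ℝ) ^ κ := Real.rpow_nonneg (by positivity) _
  calc (W.minimalDiscriminantNorm ℤ : ℝ) ≤ ((W.conductorNorm ℤ ^ 5 : ℕ) : ℝ) := by exact_mod_cast h5
    _ = (W.conductorNorm ℤ : ℝ) ^ ((5 : ℕ) : ℝ) := by rw [Real.rpow_natCast]; push_cast; ring
    _ ≤ (W.conductorNorm ℤ : ℝ) ^ κ := Real.rpow_le_rpow_of_exponent_le hN1 (by exact_mod_cast hκ)
    _ ≤ 1 * |(NumberField.discr K : ℝ)| * (W.conductorNorm ℤ : ℝ) ^ κ := by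
        nlinarith [mul_le_mul_of_nonneg_right hd1 h0]

/-! ## §3 The EC-free shadow: large-prime depth of smooth values of real index forms (Thue–Mahler) -/

/-- A binary cubic form representing zero only trivially (for cubic forms: `⇔` irreducible over `ℚ`). -/
def BinaryCubicAnisotropic (F : BinaryCubic ℤ) : Prop :=
  ∀ u v : ℤ, F.eval u v = 0 → u = 0 ∧ v = 0

/-- `ThueMahlerDepthBound B`: for fixed `M` and all large primes `p ∤ 6M`: if a real anisotropic cubic form `F`
whose discriminant is supported on `6Mp` with `p² ∤ disc F` takes, at coprime arguments, a value
`|F(u,v)| = m·p^k` with `m` supported on `6M`, then `k ≤ B`.  RANDOM MODEL: coprime `(u,v)` with `p^k ∣ F(u,v)`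
lie on `≤ 3` lattices of index `p^k` with shortest vector `≍ p^{k/2}` (Ridout floor `p^{k/(2+ε)}`), and the
cofactor `U³/p^k` must be `6M`-smooth, so `E[#depth-≥k events at p] ≍_M p^{−k/2+o(1)} × #{forms}` with
`#{forms} ≪ #Cl(ℚ(√±d₀p))[3] ≪ p^{1/3+ε}` (Ellenberg–Venkatesh): `Σ_p` converges for `k ≥ 3`, i.e. the model
predicts `B = 2` up to finitely many exceptions per `M`; `B = 3` is the safe filing (Szpiro itself forces
`n_p ≤ 6`, Bennett–Yazdani Prop. 1.2).  The cube-point / EDS families (gen-4 T1) are NOT in this regime (`ω(N) → ∞`).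
Uniformity in `p` is OPEN even for one `F` (Baker–Yu: `k ≪_F p·log p`-type bounds only).  DATA j344720 (112
Hessian-reduced real index forms `0 < D ≤ 3000`, coprime `|u| ≤ 2000, 0 ≤ v ≤ 2000`, `5.45·10⁸` values, `p > 10³`):
`k = 2`: 54 501 events (`p ≤ 233 183`), `k = 3`: 55 (all `p ≤ 2593`), `k ≥ 4`: none — the lattice-density
expectation (`≈ 30–100` for `k = 3`, `≈ 0.02` for `k = 4`); no structured excess at this scale. -/
def ThueMahlerDepthBound (B : ℕ) : Prop :=
  ∀ M : ℕ, 0 < M → ∃ p₀ : ℕ, ∀ (F : BinaryCubic ℤ) (u v : ℤ) (p k m : ℕ),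
    0 < F.disc → BinaryCubicAnisotropic F →
    (∀ q : ℕ, q.Prime → (q : ℤ) ∣ F.disc → q ∣ 6 * M * p) → ¬ ((p : ℤ) ^ 2 ∣ F.disc) →
    IsCoprime u v → p.Prime → p₀ ≤ p → ¬ p ∣ 6 * M → (∀ q : ℕ, q.Prime → q ∣ m → q ∣ 6 * M) →
    (F.eval u v).natAbs = m * p ^ k → k ≤ B

/-- **G6 (L; the dictionary — depends on k2's class parametrisation CORE A + Tate at `p`).** Every class curve is
`ℚ`-isomorphic to a quadratic twist `W_{F,u,v}^{(d)}` of `[0,0,0,−27H_F(u,v),−27G_F(u,v)]` with `F` the index form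
of `𝓞_K`, `(u,v)` coprime, `Δ(W_{F,u,v}) = 2⁴3¹²·d_K·F(u,v)²`; if `N = Mp` with `p ∥ N`, `p ∤ 6M`, then `p ∤ d`,
`rad(d_K) ∣ 2N` (Néron–Ogg–Shafarevich), `v_p(d_K) ≤ 1` (Tate: `K ⊗ ℚ_p = ℚ_p × ℚ_p(√q)`), `F(u,v)` and `d` are
supported on `6Mp`, and `n_p = v_p(d_K) + 2·v_p(F(u,v)) − 12j ≤ 2k + 1`.  Hence depth `B` for forms gives
`n_p ≤ 2B + 1` for curves. -/
theorem localIndexSzpiroMp_of_thueMahler {B : ℕ} (h : ThueMahlerDepthBound B) :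
    LocalIndexSzpiroMp (2 * B + 1) := by
  sorry

/-! ## §4 The ladder this gen adds (all arrows kernel-checked except the `sorry`'d helper bodies):
`PolylogIndexSzpiroReal A (A ≥ 3, open, sharpened target)  ⟹[G3]  stub  ⟹[G5]  LocalIndexSzpiroMp 8  ⟸[G6, B=3]
ThueMahlerDepthBound 3`;  `M = 1`: theorem (G5b, Mestre–Oesterlé);  `A < 3`: refuted on the saturating family (G4). -/

theorem ladder_top {A : ℝ} (hA : PolylogIndexSzpiroReal A) : LocalIndexSzpiroMp 8 :=
  localIndexSzpiroMp_of_stub (stub_of_polylog hA)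

end Summit.ABC.ABC.Cruxes.IndexSzpiro.StubIdeas3G5
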